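import Summits.Ventures.GridStability.Lyapunov.WSCC9LossySplitLinesLPCert
import HarnessLib

/-!
# GridStability/Bench/WSCC9LossySplitLinesLPRoa — «SPLITU-LP-8.46°»: the lossy 9-bus CERTIFIED at the window
# `2·arctan(37/500)` (≈ 8.464°) by the Lur'e–Postnikov POSITIVITY certificate on the unordered-lines split presentation

Cell `gridfusion` — LADDER-GRIDFUSION **G2.c** (classical model WITH transfer conductances); seat gridfusion-lit-6
(g9).  CONSTRUCTION companion of «SPLITU-LPCERT» (`Lyapunov/WSCC9LossySplitLinesLPCert.lean`: the exact
positivity certificate `lpCert : LPSlabCertificate WSCC9.splitLurieLinesSystem` at `γ = 2·arctan(37/500)`, `P` INDEFINITE,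
with its sector hypothesis `hsecL`): here the certificate is turned into a REGION-OF-ATTRACTION sentence for
MODEL M′ = `WSCC9.postB_SPdamp.toModel` through lit-6's LP receptacle theorem
`LPSlabCertificate.well_subset_regionOfAttraction_of_rankOne` (`LuriePostnikovSlabPositivity.lean`) and the
Lur'e-state derivative bridge `WSCC9.hasDerivWithinAt_lurieState_lines` (`Models/WSCC9SplitLurieLines.lean`) —
the same two steps lit-6's `lurieState_tendsto_zero_of_slabCertificate_lines` takes for the class of record.

* rank-one facts on the LOWER comparison matrix `P + Cᵀ·diag(λa)·C` (`lowerPQ`; the LP receptacle's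
  `lowerMatrix`, cast identity `lowerMatrix_eq`): `s_k·lowerMatrix − C_kᵀC_k ⪰ 0` for all 18 channels with
  dyadic `s_k` (`2⁻²⁰`; `1` on the null rows), decided in the kernel DIRECTLY on the formula (`rankOneL_ldl`);
* the rational inner width `γ_lo = 29519/200000` (`γ_lo²(1 + u²) ≤ 4u²`, so `γ_lo < γ`, model-2's
  `lt_two_arctan_of_sq_le`) and the RANK-ONE level `c_rk = 5766170639389/1000000000000000` (`c_rk·s_k ≤ γ_lo²` every channel);
* `lossy_splitLinesLP_slab_roa` / `_sync` / `_wellPosed` — the ROA sentence at `2·arctan(37/500)`, the LARGEST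
  certified window on M′ in the tree (#122: `2·arctan(7/100)` ≈ 8.008° with the class of record, which is EMPTY
  from 8.122° by #127; ★ #35: 7.438° on the directed-polar form);
* `γ_split8_lt_γL` — `2·arctan(7/100) < 2·arctan(37/500)`.

THREE COLUMNS.  CERTIFIED for MODEL M′ (post-fault-B Kron reduction, h12 couplings, `D_i/M_i = 1/10, 1/5, 3/10`),
CLASS = the well `{slab 2·arctan(37/500), V_LP ≤ lev}`, `lev ≤ c_rk`, `V_LP` = the Lur'e–Postnikov function of
`lpCert` (`x ⬝ Px + 2·Σ λ_k ∫ …`, coercive on the slab although `P` is indefinite).  VALIDATED: the SDP solve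
(lit-6 kit j289752) and any region-size reading.  MODELLED «WSCC9-postB-SPdamp-h12»; nothing here says the WSCC
system is stable.
[cite: Khalil2002, §7.1.2 Theorem 7.3 with §7.1 Example 7.5; Pai1981, §2.16 (2.63)–(2.64), §3.6.3 (3.43)–(3.45), §4.6 (4.45)–(4.46); VuTuritsyn2017, §4.3 Theorem 1; Hartman2002, Ch. III Thm. 5.1]
-/

noncomputable section

open Set Filter Topology Real Matrix
open Literature.MathematicalPhysics.PowerSystems
open Literature.MathematicalPhysics.PowerSystems.LyapunovFunctionFamily
open Literature.Computation.Certificates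
open Summit.Ventures.GridStability.Models
open Summit.Ventures.GridStability.Lyapunov.WSCC9LossySplitSlab (e1 eκ CQ)
open Summit.Ventures.GridStability.Lyapunov.WSCC9LossySplitLines (C_eq)
open Summit.Ventures.GridStability.Lyapunov.WSCC9LossySplitLinesLPCert

namespace Summit.Ventures.GridStability.Bench.WSCC9LossySplitLinesLP

/-! ### Rational data: window, inner width, rank-one constants, level -/

/-- The half-tangent of the window: `u = 37/500`, `γ = 2·arctan u` (≈ 8.464°). -/
def uLQ : ℚ := 37 / 500

/-- `((uLQ : ℚ) : ℝ) = 37/500`. -/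
theorem uLQ_cast : ((uLQ : ℚ) : ℝ) = 37 / 500 := by norm_num [uLQ]

/-- The rational inner width `γ_lo = 29519/200000` (`γ_lo²(1 + u²) ≤ 4u²`). -/
def gloLQ : ℚ := 29519/200000

/-- Rank-one constants `s_k` per channel (dyadic `2⁻²⁰`, rounded up from `C_k·lower⁻¹·C_kᵀ`; `1` on the six null
rows; flattened channel index, sine `(p,q) ↦ 3p+q`, cosine `↦ 9+3p+q`). -/
def sLQ : Fin 18 → ℚ :=
  ![1, 495183/131072, 1661793/524288, 495183/131072, 1, 2666099/1048576, 1661793/524288, 2666099/1048576, 1, 1, 495183/131072, 1661793/524288, 495183/131072, 1, 2666099/1048576, 1661793/524288, 2666099/1048576, 1]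

/-- `s` on the typed channel index. -/
def sL (k : (Fin 3 × Fin 3) ⊕ (Fin 3 × Fin 3)) : ℚ := sLQ (eκ k)

/-- The RANK-ONE level `c_rk = 5766170639389/1000000000000000` (`c_rk·s_k ≤ γ_lo²` on every channel). -/
def cRkLQ : ℚ := 5766170639389/1000000000000000

/-- The lower comparison matrix `P + Cᵀ·diag(λ_k a_k)·C` of `lpCert` over `ℚ` (typed index). -/
def lowerPQ : Matrix (Fin 3 ⊕ Fin 2) (Fin 3 ⊕ Fin 2) ℚ :=
  PL + CQᵀ * Matrix.diagonal (fun k => lamL k * aL k) * CQ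

/-- `γ_lo ≥ 0`, `γ_lo²(1 + u²) ≤ 4u²`, `0 < u`. -/
theorem gloL_test : 0 ≤ gloLQ ∧ gloLQ ^ 2 * (1 + uLQ ^ 2) ≤ 4 * uLQ ^ 2 ∧ 0 < uLQ := by
  refine ⟨?_, ?_, ?_⟩ <;> norm_num [gloLQ, uLQ]

/-- `0 < c_rk`. -/
theorem cRkLQ_pos : 0 < cRkLQ := by norm_num [cRkLQ]

/-- The rank-one level test: `0 < s_k` and `c_rk·s_k ≤ γ_lo²` on every channel (kernel). -/
theorem sL_tests : ∀ k, 0 < sLQ k ∧ cRkLQ * sLQ k ≤ gloLQ ^ 2 := by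
  decide +kernel

set_option maxHeartbeats 4000000 in
/-- **The eighteen rank-one facts** `s_k·(P + Cᵀ·diag(λa)·C) − C_kᵀC_k ⪰ 0` (5 × 5 each), decided in the kernel on
the formula. [cite: VuTuritsyn2017, §4.3 Theorem 1 (eq. V_min); Khalil2002, §7.1.2 Theorem 7.3] -/
theorem rankOneL_ldl : ∀ k : (Fin 3 × Fin 3) ⊕ (Fin 3 × Fin 3),
    PSD.LDLCert ((sL k • lowerPQ - Matrix.vecMulVec (CQ k) (CQ k)).submatrix e1.symm e1.symm) := by
  decide +kernel

/-- `γ_lo < γ = 2·arctan(37/500)` (model-2's `lt_two_arctan_of_sq_le`). -/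
theorem gloLQ_lt_gamma : ((gloLQ : ℚ) : ℝ) < 2 * Real.arctan (37 / 500 : ℝ) := by
  rw [← uLQ_cast]
  exact StructurePreserving.lt_two_arctan_of_sq_le (by exact_mod_cast gloL_test.2.2)
    (by exact_mod_cast gloL_test.1) (by exact_mod_cast gloL_test.2.1)

/-! ### Cast identities: the LP receptacle's `lowerMatrix` and the rank-one facts over `ℝ` -/

/-- `(M·N) ↦ ℝ` (plumbing). -/
private theorem map_mul' {m n o : Type*} [Fintype n] (M : Matrix m n ℚ) (N : Matrix n o ℚ) :
    (M * N).map (Rat.cast : ℚ → ℝ) = M.map (Rat.cast : ℚ → ℝ) * N.map (Rat.cast : ℚ → ℝ) :=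
  Matrix.map_mul (f := Rat.castHom ℝ)
/-- `(M + N) ↦ ℝ` (plumbing). -/
private theorem map_add' {m n : Type*} (M N : Matrix m n ℚ) :
    (M + N).map (Rat.cast : ℚ → ℝ) = M.map (Rat.cast : ℚ → ℝ) + N.map (Rat.cast : ℚ → ℝ) := by
  ext; simp
/-- `(M − N) ↦ ℝ` (plumbing). -/
private theorem map_sub' {m n : Type*} (M N : Matrix m n ℚ) :
    (M - N).map (Rat.cast : ℚ → ℝ) = M.map (Rat.cast : ℚ → ℝ) - N.map (Rat.cast : ℚ → ℝ) := by
  ext; simp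
/-- `Mᵀ ↦ ℝ` (plumbing). -/
private theorem map_transpose' {m n : Type*} (M : Matrix m n ℚ) :
    Mᵀ.map (Rat.cast : ℚ → ℝ) = (M.map (Rat.cast : ℚ → ℝ))ᵀ := by
  ext; simp
/-- `diagonal d ↦ ℝ` (plumbing). -/
private theorem map_diagonal' {n : Type*} [DecidableEq n] (d : n → ℚ) :
    (Matrix.diagonal d).map (Rat.cast : ℚ → ℝ) = Matrix.diagonal (fun i => ((d i : ℚ) : ℝ)) :=
  Matrix.diagonal_map (Rat.cast_zero)
/-- `(q • M) ↦ ℝ` (plumbing). -/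
private theorem map_smul' {m n : Type*} (q : ℚ) (M : Matrix m n ℚ) :
    (q • M).map (Rat.cast : ℚ → ℝ) = ((q : ℚ) : ℝ) • M.map (Rat.cast : ℚ → ℝ) := by
  ext; simp
/-- `vecMulVec v w ↦ ℝ` (plumbing). -/
private theorem map_vecMulVec' {m n : Type*} (v : m → ℚ) (w : n → ℚ) :
    (Matrix.vecMulVec v w).map (Rat.cast : ℚ → ℝ)
      = Matrix.vecMulVec (fun i => ((v i : ℚ) : ℝ)) (fun j => ((w j : ℚ) : ℝ)) := by
  ext; simp [Matrix.vecMulVec_apply]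

/-- **`lpCert.lowerMatrix = lowerPQ ↦ ℝ`.** -/
theorem lowerMatrix_eq : lpCert.lowerMatrix = lowerPQ.map (Rat.cast : ℚ → ℝ) := by
  have hd : Matrix.diagonal (fun k => lpCert.lam k * lpCert.a k)
      = (Matrix.diagonal (fun k => lamL k * aL k)).map (Rat.cast : ℚ → ℝ) := by
    rw [map_diagonal']
    congr 1; funext k
    show lamr k * ar k = _
    simp [lamr, ar]
  rw [LPSlabCertificate.lowerMatrix_def, hd, C_eq, lowerPQ]
  show Pr + _ = _
  rw [Pr]
  simp only [map_add', map_mul', map_transpose']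

/-- **Rank-one facts over `ℝ`** for every channel of `WSCC9.splitLurieLinesSystem` with the LOWER matrix of `lpCert`.
[cite: VuTuritsyn2017, §4.3 Theorem 1 (eq. V_min); Khalil2002, §7.1.2 Theorem 7.3] -/
theorem rankOneL (k : (Fin 3 × Fin 3) ⊕ (Fin 3 × Fin 3)) :
    ((((sL k : ℚ) : ℝ)) • lpCert.lowerMatrix
      - Matrix.vecMulVec (WSCC9.splitLurieLinesSystem.C k) (WSCC9.splitLurieLinesSystem.C k)).PosSemidef := by
  have hC : WSCC9.splitLurieLinesSystem.C k = fun i => ((CQ k i : ℚ) : ℝ) := by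
    rw [C_eq]; rfl
  have h : (((sL k : ℚ) : ℝ)) • lpCert.lowerMatrix - Matrix.vecMulVec (WSCC9.splitLurieLinesSystem.C k) (WSCC9.splitLurieLinesSystem.C k)
      = (sL k • lowerPQ - Matrix.vecMulVec (CQ k) (CQ k)).map (Rat.cast : ℚ → ℝ) := by
    rw [hC, lowerMatrix_eq, map_sub', map_smul', map_vecMulVec']
  rw [h]
  have hpsd := ((rankOneL_ldl k).posSemidef (R := ℝ)).submatrix e1
  have e : (((sL k • lowerPQ - Matrix.vecMulVec (CQ k) (CQ k)).submatrix ⇑e1.symm ⇑e1.symm).map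
      (Rat.cast : ℚ → ℝ)).submatrix e1 e1
      = (sL k • lowerPQ - Matrix.vecMulVec (CQ k) (CQ k)).map (Rat.cast : ℚ → ℝ) := by
    ext i j; simp
  rwa [e] at hpsd

/-- `0 < s_k` (real). -/
theorem sL_pos (k : (Fin 3 × Fin 3) ⊕ (Fin 3 × Fin 3)) : (0 : ℝ) < ((sL k : ℚ) : ℝ) := by
  unfold sL; exact_mod_cast (sL_tests (eκ k)).1

/-- **`hlevL`**: `lev ≤ c_rk ⇒ lev < γ²/s_k` on every channel (`c_rk·s_k ≤ γ_lo² < γ²`). -/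
theorem hlevL {lev : ℝ} (hle : lev ≤ ((cRkLQ : ℚ) : ℝ)) (k : (Fin 3 × Fin 3) ⊕ (Fin 3 × Fin 3)) :
    lev < (2 * Real.arctan (37 / 500 : ℝ)) ^ 2 / ((sL k : ℚ) : ℝ) := by
  have hs : (0 : ℝ) < ((sL k : ℚ) : ℝ) := sL_pos k
  have ht : ((cRkLQ : ℚ) : ℝ) * ((sL k : ℚ) : ℝ) ≤ ((gloLQ : ℚ) : ℝ) ^ 2 := by
    unfold sL; exact_mod_cast (sL_tests (eκ k)).2
  have hg : ((gloLQ : ℚ) : ℝ) ^ 2 < (2 * Real.arctan (37 / 500 : ℝ)) ^ 2 :=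
    pow_lt_pow_left₀ gloLQ_lt_gamma (by exact_mod_cast gloL_test.1) two_ne_zero
  rw [lt_div_iff₀ hs]
  nlinarith

/-! ### The ROA sentence -/

/-- **«SPLITU-LP-8.46°» — the certified region of the post-fault WSCC 3-machine classical model WITH TRANSFER
CONDUCTANCES at the window `2·arctan(37/500)` (≈ 8.464°), unordered-lines split presentation, POSITIVITY class.**
For MODEL M′ = `WSCC9.postB_SPdamp.toModel`: every solution `c` on `ℝ` whose initial Lur'e state lies in the open
slab `γ = 2·arctan(37/500)` (every `|(δ_p − δ_q) − (θ*_p − θ*_q)| < γ`, `Bench.WSCC9LossySplitLines.mem_slab_iff`)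
and has `V_LP ≤ lev` for a level `lev ≤ c_rk = 5766170639389/1000000000000000` (`V_LP` = `lpCert.V`, the Lur'e–Postnikov
function of the positivity certificate) keeps BOTH for all `t ≥ 0` and has `lurieState → 0`.  At this window
the slab/Popov class of record is EMPTY (#127); the region comes from the WIDER positivity class.
[cite: Khalil2002, §7.1.2 Theorem 7.3; Pai1981, §3.6.3 eqs. (3.43)–(3.45); VuTuritsyn2017, §4.3 Theorem 1] -/
theorem lossy_splitLinesLP_slab_roa {lev : ℝ} (hle : lev ≤ ((cRkLQ : ℚ) : ℝ))
    {c : ℝ → ClassicalSwing.State 3} (hc : WSCC9.postB_SPdamp.toModel.IsSolutionOn c univ)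
    (h0 : WSCC9.postB_SPdamp.lurieState WSCC9.postB_SPdamp.angleOf (c 0) ∈ WSCC9.splitLurieLinesSystem.slab (fun _ => 2 * Real.arctan (37 / 500 : ℝ)))
    (h0c : lpCert.V (WSCC9.postB_SPdamp.lurieState WSCC9.postB_SPdamp.angleOf (c 0)) ≤ lev) :
    (∀ t, 0 ≤ t →
        WSCC9.postB_SPdamp.lurieState WSCC9.postB_SPdamp.angleOf (c t) ∈ WSCC9.splitLurieLinesSystem.slab (fun _ => 2 * Real.arctan (37 / 500 : ℝ)) ∧
          lpCert.V (WSCC9.postB_SPdamp.lurieState WSCC9.postB_SPdamp.angleOf (c t)) ≤ lev) ∧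
      Tendsto (fun t => WSCC9.postB_SPdamp.lurieState WSCC9.postB_SPdamp.angleOf (c t)) atTop (𝓝 0) := by
  have key := lpCert.well_subset_regionOfAttraction_of_rankOne (γ := fun _ => 2 * Real.arctan (37 / 500 : ℝ)) hsecL
    (fun k => sL_pos k) rankOneL (hlevL hle) (y := WSCC9.postB_SPdamp.lurieState WSCC9.postB_SPdamp.angleOf (c 0)) ⟨h0, h0c⟩
  have h2 := key.2 (fun t => WSCC9.postB_SPdamp.lurieState WSCC9.postB_SPdamp.angleOf (c t)) rfl
    fun T t _ => WSCC9.hasDerivWithinAt_lurieState_lines hc t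
  exact ⟨fun t ht => ⟨(h2.1 t ht).1, (h2.1 t ht).2⟩, h2.2⟩

/-- **The same, read in machine coordinates (synchronisation).** For all `t ≥ 0` every machine-angle-difference
deviation stays `< 2·arctan(37/500)`; every speed deviation `ω_i(t) → 0`; every relative angle
`δ_{a+1}(t) − δ_0(t) → θ*_{a+1} − θ*_0`.  MODELLED «WSCC9-postB-SPdamp-h12»; nothing here says the WSCC system is
stable. [cite: Pai1981, §3.6.3 eqs. (3.43)–(3.45); Khalil2002, §7.1.2 Theorem 7.3] -/
theorem lossy_splitLinesLP_slab_sync {lev : ℝ} (hle : lev ≤ ((cRkLQ : ℚ) : ℝ))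
    {c : ℝ → ClassicalSwing.State 3} (hc : WSCC9.postB_SPdamp.toModel.IsSolutionOn c univ)
    (h0 : ∀ p q : Fin 3, |((c 0).1 p - (c 0).1 q) - (WSCC9.postB_SPdamp.angleOf p - WSCC9.postB_SPdamp.angleOf q)|
      < 2 * Real.arctan (37 / 500 : ℝ))
    (h0c : lpCert.V (WSCC9.postB_SPdamp.lurieState WSCC9.postB_SPdamp.angleOf (c 0)) ≤ lev) :
    (∀ t, 0 ≤ t → ∀ p q : Fin 3,
        |((c t).1 p - (c t).1 q) - (WSCC9.postB_SPdamp.angleOf p - WSCC9.postB_SPdamp.angleOf q)|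
          < 2 * Real.arctan (37 / 500 : ℝ)) ∧
      (∀ i : Fin 3, Tendsto (fun t => (c t).2 i) atTop (𝓝 0)) ∧
      ∀ a : Fin 2, Tendsto (fun t => (c t).1 a.succ - (c t).1 0) atTop
        (𝓝 (WSCC9.postB_SPdamp.angleOf a.succ - WSCC9.postB_SPdamp.angleOf 0)) := by
  obtain ⟨hkeep, hlim⟩ := lossy_splitLinesLP_slab_roa hle hc
    ((WSCC9LossySplitLines.mem_slab_iff _ _).2 h0) h0c
  have hcoord := tendsto_pi_nhds.1 hlim
  refine ⟨fun t ht => (WSCC9LossySplitLines.mem_slab_iff _ _).1 (hkeep t ht).1, fun i => ?_, fun a => ?_⟩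
  · have h := hcoord (Sum.inl i)
    simp only [RecastData.lurieState_eq, Sum.elim_inl, Pi.zero_apply] at h
    exact h
  · have h := hcoord (Sum.inr a)
    simp only [RecastData.lurieState_eq, Sum.elim_inr, Pi.zero_apply] at h
    have h2 := h.add_const (WSCC9.postB_SPdamp.angleOf a.succ - WSCC9.postB_SPdamp.angleOf 0)
    simp only [zero_add, sub_add_cancel] at h2
    exact h2

/-- **«SPLITU-LP-8.46°», well-posed form**: for every machine state `z` with all
`|(δ_p − δ_q) − (θ*_p − θ*_q)| < 2·arctan(37/500)` and `V_LP(z) ≤ lev ≤ c_rk`: a solution of M′ on `ℝ` from `z`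
EXISTS, every solution from `z` is that one, and along it the deviations stay `< 2·arctan(37/500)` with
`V_LP ≤ lev`, every `ω_i(t) → 0` and every relative angle converges to its equilibrium value.
[cite: Pai1981, §3.6.3 eqs. (3.43)–(3.45); Khalil2002, §7.1.2 Theorem 7.3; Hartman2002, Ch. III Thm. 5.1] -/
theorem lossy_splitLinesLP_slab_wellPosed {lev : ℝ} (hle : lev ≤ ((cRkLQ : ℚ) : ℝ)) (z : ClassicalSwing.State 3)
    (hz : ∀ p q : Fin 3, |(z.1 p - z.1 q) - (WSCC9.postB_SPdamp.angleOf p - WSCC9.postB_SPdamp.angleOf q)|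
      < 2 * Real.arctan (37 / 500 : ℝ))
    (hzc : lpCert.V (WSCC9.postB_SPdamp.lurieState WSCC9.postB_SPdamp.angleOf z) ≤ lev) :
    (∃ c : ℝ → ClassicalSwing.State 3, c 0 = z ∧ WSCC9.postB_SPdamp.toModel.IsSolutionOn c univ) ∧
      ∀ c : ℝ → ClassicalSwing.State 3, c 0 = z → WSCC9.postB_SPdamp.toModel.IsSolutionOn c univ →
        (∀ c' : ℝ → ClassicalSwing.State 3, c' 0 = z → WSCC9.postB_SPdamp.toModel.IsSolutionOn c' univ →
            c' = c) ∧
        (∀ t, 0 ≤ t →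
          (∀ p q : Fin 3,
              |((c t).1 p - (c t).1 q) - (WSCC9.postB_SPdamp.angleOf p - WSCC9.postB_SPdamp.angleOf q)|
                < 2 * Real.arctan (37 / 500 : ℝ)) ∧
            lpCert.V (WSCC9.postB_SPdamp.lurieState WSCC9.postB_SPdamp.angleOf (c t)) ≤ lev) ∧
        (∀ i : Fin 3, Tendsto (fun t => (c t).2 i) atTop (𝓝 0)) ∧
        ∀ a : Fin 2, Tendsto (fun t => (c t).1 a.succ - (c t).1 0) atTop
          (𝓝 (WSCC9.postB_SPdamp.angleOf a.succ - WSCC9.postB_SPdamp.angleOf 0)) := by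
  refine ⟨WSCC9.postB_SPdamp_exists_solution z, fun c hc0 hc => ?_⟩
  have hkeep := lossy_splitLinesLP_slab_roa hle hc
    ((WSCC9LossySplitLines.mem_slab_iff _ _).2 (hc0.symm ▸ hz)) (hc0.symm ▸ hzc)
  have hsync := lossy_splitLinesLP_slab_sync hle hc (hc0.symm ▸ hz) (hc0.symm ▸ hzc)
  refine ⟨fun c' hc0' hc' => WSCC9.postB_SPdamp_solution_unique hc' hc (hc0'.trans hc0.symm), ?_,
    hsync.2.1, hsync.2.2⟩
  intro t ht
  exact ⟨hsync.1 t ht, (hkeep.1 t ht).2⟩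

/-- **The largest certified window on M′ in the tree moves from 8.008° to 8.464°**:
`2·arctan(7/100) < 2·arctan(37/500)` (#122's window, class of record — EMPTY from 8.122° by #127 — vs this file's,
positivity class). -/
theorem γ_split8_lt_γL : 2 * Real.arctan (7 / 100 : ℝ) < 2 * Real.arctan (37 / 500 : ℝ) := by
  have := Real.arctan_strictMono (show (7 / 100 : ℝ) < 37 / 500 by norm_num)
  linarith


/-! ### APPEND (lit-6 g9, 2026-08-27T22:1xZ): THE CERTIFIED INNER BALL of the positivity-class region

lit-6's `LPSlabCertificate.ball_subset_well` (`LuriePostnikovSlabPositivity.lean` §6): with `t·1 − upperMatrix ⪰ 0`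
(`upperMatrix = P + Cᵀ·diag(λb)·C`), `t·ϱ ≤ c_rk` and `(C_kᵀC_k)·ϱ < γ²` the Euclidean ball `{x : xᵀx ≤ ϱ}` of the
Lur'e state lies in the certified well.  Here `t = 909/1024` (kernel `LDLᵀ` on the formula), `ϱ = 405979/62500000`
(`√ϱ ≈ 0.0806`): every motion of M′ whose initial Lur'e state `(ω, σ)` has `|x|² ≤ ϱ` is covered — CERTIFIED;
the comparison with ★ #122's region (VALIDATED inner ball `√ϱ ≈ 0.0027` by the same recipe on its literals,
lit-6 probe) is a VALIDATED reading: the positivity certificate's LOWER-matrix rank-one level is ≈ 800× higher.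
[cite: Khalil2002, Theorem 4.10 (hypothesis (4.25)); VuTuritsyn2017, §4.3 Theorem 1 (set ℛ)] -/

/-- The upper constant `t = 909/1024` (`t·1 − (P + Cᵀ·diag(λb)·C) ⪰ 0`). -/
def tUQ : ℚ := 909 / 1024

/-- The certified ball radius²: `ϱ = 405979/62500000` (`t·ϱ ≤ c_rk`, `2ϱ ≤ γ_lo²`). -/
def rho2LQ : ℚ := 405979 / 62500000

/-- The upper comparison matrix `P + Cᵀ·diag(λ_k b_k)·C` of `lpCert` over `ℚ` (typed index). -/
def upperPQ : Matrix (Fin 3 ⊕ Fin 2) (Fin 3 ⊕ Fin 2) ℚ :=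
  PL + CQᵀ * Matrix.diagonal (fun k => lamL k * bL k) * CQ

set_option maxHeartbeats 4000000 in
/-- **`t·1 − (P + Cᵀ·diag(λb)·C) ⪰ 0`** (5 × 5), decided in the kernel on the formula. -/
theorem upperL_ldl :
    PSD.LDLCert ((tUQ • (1 : Matrix (Fin 3 ⊕ Fin 2) (Fin 3 ⊕ Fin 2) ℚ) - upperPQ).submatrix e1.symm e1.symm) := by
  decide +kernel

/-- The ball tests: `0 ≤ t`, `t·ϱ ≤ c_rk`, `2ϱ ≤ γ_lo²`, `0 < ϱ`. -/
theorem ball_tests : 0 ≤ tUQ ∧ tUQ * rho2LQ ≤ cRkLQ ∧ 2 * rho2LQ ≤ gloLQ ^ 2 ∧ 0 < rho2LQ := by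
  refine ⟨?_, ?_, ?_, ?_⟩ <;> norm_num [tUQ, rho2LQ, cRkLQ, gloLQ]

/-- `C_kᵀC_k ≤ 2` for every channel (`0` on the null rows, `1` on `±e_σ`, `2` on `±(e_σ₁ − e_σ₂)`; kernel). -/
theorem CQ_sq_le_two : ∀ k : (Fin 3 × Fin 3) ⊕ (Fin 3 × Fin 3), CQ k ⬝ᵥ CQ k ≤ 2 := by
  decide +kernel

/-- **`lpCert.upperMatrix = upperPQ ↦ ℝ`.** -/
theorem upperMatrix_eq : lpCert.upperMatrix = upperPQ.map (Rat.cast : ℚ → ℝ) := by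
  have hd : Matrix.diagonal (fun k => lpCert.lam k * lpCert.b k)
      = (Matrix.diagonal (fun k => lamL k * bL k)).map (Rat.cast : ℚ → ℝ) := by
    rw [map_diagonal']
    congr 1; funext k
    show lamr k * br k = _
    simp [lamr, br]
  rw [LPSlabCertificate.upperMatrix, hd, C_eq, upperPQ]
  show Pr + _ = _
  rw [Pr]
  simp only [map_add', map_mul', map_transpose']

/-- `(q • 1) ↦ ℝ` (plumbing). -/
private theorem map_smul_one' {n : Type*} [DecidableEq n] (q : ℚ) :
    (q • (1 : Matrix n n ℚ)).map (Rat.cast : ℚ → ℝ) = ((q : ℚ) : ℝ) • (1 : Matrix n n ℝ) := by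
  ext i j; by_cases h : i = j <;> simp [h]

/-- **`t·1 − upperMatrix ⪰ 0` over `ℝ`.** -/
theorem upper_psd :
    (((tUQ : ℚ) : ℝ) • (1 : Matrix (Fin 3 ⊕ Fin 2) (Fin 3 ⊕ Fin 2) ℝ) - lpCert.upperMatrix).PosSemidef := by
  have h : ((tUQ : ℚ) : ℝ) • (1 : Matrix (Fin 3 ⊕ Fin 2) (Fin 3 ⊕ Fin 2) ℝ) - lpCert.upperMatrix
      = (tUQ • (1 : Matrix (Fin 3 ⊕ Fin 2) (Fin 3 ⊕ Fin 2) ℚ) - upperPQ).map (Rat.cast : ℚ → ℝ) := by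
    rw [upperMatrix_eq, map_sub', map_smul_one']
  rw [h]
  have hpsd := (upperL_ldl.posSemidef (R := ℝ)).submatrix e1
  have e : (((tUQ • (1 : Matrix (Fin 3 ⊕ Fin 2) (Fin 3 ⊕ Fin 2) ℚ) - upperPQ).submatrix ⇑e1.symm ⇑e1.symm).map
      (Rat.cast : ℚ → ℝ)).submatrix e1 e1
      = (tUQ • (1 : Matrix (Fin 3 ⊕ Fin 2) (Fin 3 ⊕ Fin 2) ℚ) - upperPQ).map (Rat.cast : ℚ → ℝ) := by
    ext i j; simp
  rwa [e] at hpsd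

/-- **THE CERTIFIED INNER BALL**: the Euclidean ball `{x : xᵀx ≤ ϱ}`, `ϱ = 405979/62500000` (`√ϱ ≈ 0.0806`), of the
Lur'e state is contained in the certified well `{slab 2·arctan(37/500), V_LP ≤ c_rk}`.
[cite: Khalil2002, Theorem 4.10 (hypothesis (4.25)); VuTuritsyn2017, §4.3 Theorem 1 (set ℛ)] -/
theorem ball_subset_wellL :
    {x : Fin 3 ⊕ Fin 2 → ℝ | x ⬝ᵥ x ≤ ((rho2LQ : ℚ) : ℝ)}
      ⊆ lpCert.well (fun _ => 2 * Real.arctan (37 / 500 : ℝ)) ((cRkLQ : ℚ) : ℝ) := by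
  have hγ : (0 : ℝ) < 2 * Real.arctan (37 / 500 : ℝ) := by
    have := Real.arctan_pos.mpr (show (0 : ℝ) < 37 / 500 by norm_num)
    linarith
  refine lpCert.ball_subset_well (γ := fun _ => 2 * Real.arctan (37 / 500 : ℝ)) (fun _ => hγ)
    (by exact_mod_cast ball_tests.1) upper_psd hsecL (by exact_mod_cast ball_tests.2.1) fun k => ?_
  have hC : WSCC9.splitLurieLinesSystem.C k = fun i => ((CQ k i : ℚ) : ℝ) := by
    rw [C_eq]; rfl
  have h1 : WSCC9.splitLurieLinesSystem.C k ⬝ᵥ WSCC9.splitLurieLinesSystem.C k = ((CQ k ⬝ᵥ CQ k : ℚ) : ℝ) := by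
    rw [hC]; simp [dotProduct]
  have h2 : ((CQ k ⬝ᵥ CQ k : ℚ) : ℝ) ≤ 2 := by exact_mod_cast CQ_sq_le_two k
  have h3 : (2 : ℝ) * ((rho2LQ : ℚ) : ℝ) ≤ ((gloLQ : ℚ) : ℝ) ^ 2 := by exact_mod_cast ball_tests.2.2.1
  have h4 : ((gloLQ : ℚ) : ℝ) ^ 2 < (2 * Real.arctan (37 / 500 : ℝ)) ^ 2 :=
    pow_lt_pow_left₀ gloLQ_lt_gamma (by exact_mod_cast gloL_test.1) two_ne_zero
  have h5 : (0 : ℝ) < ((rho2LQ : ℚ) : ℝ) := by exact_mod_cast ball_tests.2.2.2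
  rw [h1]
  nlinarith

/-- **«SPLITU-LP-8.46°», ball form**: every solution of M′ on `ℝ` whose initial Lur'e state `x(0) = (ω, σ)(0)` has
`|x(0)|² ≤ ϱ = 405979/62500000` keeps the slab `2·arctan(37/500)` and `V_LP ≤ c_rk` for all `t ≥ 0` and has
`lurieState → 0` (synchronises).  CERTIFIED for MODEL M′; the ball is an INNER estimate of the certified well.
[cite: Khalil2002, Theorem 4.10, §7.1.2 Theorem 7.3; VuTuritsyn2017, §4.3 Theorem 1] -/
theorem lossy_splitLinesLP_ball_roa {c : ℝ → ClassicalSwing.State 3}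
    (hc : WSCC9.postB_SPdamp.toModel.IsSolutionOn c univ)
    (h0 : WSCC9.postB_SPdamp.lurieState WSCC9.postB_SPdamp.angleOf (c 0) ⬝ᵥ WSCC9.postB_SPdamp.lurieState WSCC9.postB_SPdamp.angleOf (c 0) ≤ ((rho2LQ : ℚ) : ℝ)) :
    (∀ t, 0 ≤ t →
        WSCC9.postB_SPdamp.lurieState WSCC9.postB_SPdamp.angleOf (c t) ∈ WSCC9.splitLurieLinesSystem.slab (fun _ => 2 * Real.arctan (37 / 500 : ℝ)) ∧
          lpCert.V (WSCC9.postB_SPdamp.lurieState WSCC9.postB_SPdamp.angleOf (c t)) ≤ ((cRkLQ : ℚ) : ℝ)) ∧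
      Tendsto (fun t => WSCC9.postB_SPdamp.lurieState WSCC9.postB_SPdamp.angleOf (c t)) atTop (𝓝 0) := by
  have hw := ball_subset_wellL h0
  exact lossy_splitLinesLP_slab_roa le_rfl hc hw.1 hw.2

end Summit.Ventures.GridStability.Bench.WSCC9LossySplitLinesLP

end
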